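import Summits.BirchSwinnertonDyer.BirchSwinnertonDyer.Theorems.PrintCFramBottomClassIndexLawFiveLeEisensteinSockets
import Summits.BirchSwinnertonDyer.BirchSwinnertonDyer.Theorems.PrintCFramBottomClassIndexLawFiveLeEisensteinUpgradeOfModuleInvariants
import HarnessLib

/-!
# Route `PrintCFram`, crux C2 `BottomClassIndexLawFiveLe` (stmt-BirchSwinnertonDyer-20372), line `eisenstein-resource-bdp-line`:
# END STATE BY NAME after the LEAD g3 reductions — C2 ⟸ {11 refereed named facts} ∧ (β1) the ♭-(∅,0) Eisenstein inclusion ∧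
# (β2′) the Greenberg–Vatsal invariant match «X torsion, μ(Q) = μ(X), λ(Q) = λ(X)» — the two ITEM-SHAPED research residuals
# (cell `bsd-print-cfram`, seat `bsd-line-cfram-p1` LEAD g3; helper `--supports` 20372; ONE theorem, 0 facts)

HONEST FRAMING. Nothing about BSD is proved; C2 and the leaf stay OPEN; this is the line's composition with the registered upgrade
stub REPLACED by its proved reduction (`stub_invariantUpgrade_cmRamified_of_moduleInvariants`, p619535). It is the statement the
planner can promote: children of C2 = (β1) `h1` verbatim = registered `stub_flatEisensteinIncl_cmRamified` (research-XL: the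
Eisenstein-congruence lattice construction for `f_W/K''` at the supercuspidal prime; 0 printed engines) and (β2′) `hinvM` (research-L:
CGLS 2022 Thm. 3.2.1 + (an-inv) transplanted to an additive split prime), glue = this theorem + `stub_prints` (citations). BSD is not
proved by any of this; no summit statement is proved by this seat.

References: Castella–Grossi–Lee–Skinner, Invent. Math. 227 (2022) Thm. 3.2.1, §3.3, Thm. 5.1.1 [CastellaGrossiLeeSkinner2022];
Jetchev–Skinner–Wan 2017 §7.4.1 [JetchevSkinnerWan2017]; Burungale–Flach 2024 Cor. 2 [BurungaleFlach2024]; R. Miller 2011 Def. 1.1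
[Miller2011LMS].
-/

noncomputable section

open scoped Classical

set_option linter.dupNamespace false
set_option autoImplicit false

namespace Summit.BirchSwinnertonDyer.BirchSwinnertonDyer.Theorems.PrintCFram.EisensteinResourceBdpLine

open WeierstrassCurve NumberField IsDedekindDomain Field PowerSeries
  Literature.NumberTheory.EllipticCurves
  Literature.NumberTheory.EllipticCurves.ModularForms
  Literature.NumberTheory.EllipticCurves.Rank1Residual
  Literature.NumberTheory.EllipticCurves.Rank1Residual.Typed
  Literature.NumberTheory.EllipticCurves.KrizLi2019
  Literature.NumberTheory.GaloisRepresentations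
  Literature.NumberTheory.GaloisCohomology
  Summit.BirchSwinnertonDyer.Rank1Residual
  Summit.BirchSwinnertonDyer.Rank1Residual.Additive
  Summit.BirchSwinnertonDyer.Rank1Residual.X11b
  Summit.BirchSwinnertonDyer.Rank1Residual.X11b.AcSelmer
  Summit.BirchSwinnertonDyer.Rank1Residual.X11b.Halves
  Summit.BirchSwinnertonDyer.Rank1Residual.X11b.CongruenceLimit
  Summit.BirchSwinnertonDyer.Rank1Residual.X12
  Summit.BirchSwinnertonDyer.BirchSwinnertonDyer.Theses.UniversalToricDescent
  Summit.BirchSwinnertonDyer.BirchSwinnertonDyer.Theorems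
  Summit.BirchSwinnertonDyer.BirchSwinnertonDyer.Theorems.SchneiderFree
  Summit.BirchSwinnertonDyer.BirchSwinnertonDyer.Theorems.SchneiderFreeControlAtoms
  Summit.BirchSwinnertonDyer.BirchSwinnertonDyer.Theorems.SchneiderFreeAdditiveX3
  Summit.BirchSwinnertonDyer.BirchSwinnertonDyer.Theorems.UniversalToricDescentWaldspurgerFlat
  Summit.BirchSwinnertonDyer.BirchSwinnertonDyer.Theorems.AdditivePotSupersingularControl
  Summit.BirchSwinnertonDyer.BirchSwinnertonDyer.Theorems.RamifiedSevenEllipticUnits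

/-- **END STATE of line `eisenstein-resource-bdp-line` after LEAD g3, BY NAME**: the crux
`Theses.PrintCFram.BottomClassIndexLawFiveLe` follows from the facts-stub `h0` (= `stub_prints`: eleven refereed named facts), the
Eisenstein inclusion `h1` (= `stub_flatEisensteinIncl_cmRamified`, verbatim) and the Greenberg–Vatsal invariant match `hinvM`
(«at every frame where `h1`'s inclusion holds: `X_(∅,0)(W/K''_∞)` is f.g. torsion and `Q = C(p^{μ(X)})·Q₀` with `ord Q̄₀ = λ(X)`»).
Proof: `stub_invariantUpgrade_cmRamified_of_moduleInvariants hinvM` is stub 2; then the line's composition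
`bottomClassIndexLawFiveLe_of_prints_of_flatIncl_of_upgrade`. CONDITIONAL on the three displayed hypotheses; nothing booked.
[cite: CastellaGrossiLeeSkinner2022, Thm. 3.2.1 and proof of Thm. 5.1.1 (arXiv:2008.02571 pp. 4, 23)]
[cite: JetchevSkinnerWan2017, §7.4.1 (arXiv:1512.06894 p. 30)] [cite: Miller2011LMS, Def. 1.1 (arXiv:1010.2431 p. 3)] -/
theorem bottomClassIndexLawFiveLe_of_prints_of_flatIncl_of_moduleInvariants
    (h0 : Hsieh2014.thmA_exists_isHsiehLFunction_unrPeriod_anyLevel ∧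
    LiuZhangZhang2018.thm151_thm153_modularCurve_heegnerVector_additive ∧
    ToricPublishedInputs ∧
    (∀ (K : Type) [Field K] [NumberField K], poitouTate_selmerStructure_duality K) ∧
    (∀ (K : Type) [Field K] [NumberField K], poitouTate_sha_tateDual K) ∧
    (∀ (K : Type) [Field K] [NumberField K] (v : HeightOneSpectrum (𝓞 K)),
      localEulerPoincareCharacteristic (v.adicCompletion K)) ∧
    fieldCdLE_two_of_numberField ∧
    (∀ (K : Type) [Field K] [NumberField K] (p : ℕ) [Fact p.Prime],
      ZpExtension.decomp_not_le_kerSubgroup_of_isAnticyclotomic K p) ∧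
    bsdTriple_of_hasCM_of_L_one_ne_zero ∧
    hasEntireLFunction_rat ∧
    bsdRHS_eq_of_isIsogenous)
    (h1 : ∀ (p : ℕ) [Fact p.Prime] (W : WeierstrassCurve ℚ) [W.IsElliptic] [W.IsGloballyMinimal],
      W.HasCM → CMRamified W p → 5 ≤ p → W.analyticRank = 1 →
      ∀ (N : ℕ) [NeZero N] (K : Type) [Field K] [NumberField K] (Dt : ModularParametrizationData W N),
      W.conductorNorm ℤ = N → IsImaginaryQuadratic K → SatisfiesHeegnerHypothesis N K →
      ∀ (κ : ZpExtension K p), κ.IsAnticyclotomic → ∀ (γ : Field.absoluteGaloisGroup K) [Fact (κ.IsTopGenerator γ)]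
        (𝔭 : HeightOneSpectrum (𝓞 K)), ((p : ℕ) : 𝓞 K) ∈ 𝔭.asIdeal → 𝔭.asIdeal.ramificationIdx (𝓞 ℚ) = 1 →
        𝔭.asIdeal.inertiaDeg (𝓞 ℚ) = 1 → ∀ (𝔭' : HeightOneSpectrum (𝓞 K)), ((p : ℕ) : 𝓞 K) ∈ 𝔭'.asIdeal → 𝔭' ≠ 𝔭 →
        ∀ (ι' : PadicAlgCl p ≃+* ℂ), SchneiderFree.BranchInducesPrime p ι' 𝔭 →
        ∀ (ΩK : ℂ) (Ωp : ℂ_[p]) (Q : PowerSeries (PadicComplexInt p)), ΩK ≠ 0 → Ωp ≠ 0 →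
          R1.IsBDPLFunctionInt p ι' 𝔭 κ γ Dt.f ΩK Ωp Q →
          (XAc.charIdeal (W.baseChange K) p κ 𝔭' ∅ γ).map (PowerSeries.map (R1.toCpInt p)) ≤ Ideal.span {Q})
    (hinvM : ∀ (p : ℕ) [Fact p.Prime] (W : WeierstrassCurve ℚ) [W.IsElliptic] [W.IsGloballyMinimal],
      W.HasCM → CMRamified W p → 5 ≤ p → W.analyticRank = 1 →
      ∀ (N : ℕ) [NeZero N] (K : Type) [Field K] [NumberField K] (Dt : ModularParametrizationData W N),
      W.conductorNorm ℤ = N → IsImaginaryQuadratic K → SatisfiesHeegnerHypothesis N K →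
      ∀ (κ : ZpExtension K p), κ.IsAnticyclotomic → ∀ (γ : Field.absoluteGaloisGroup K) [Fact (κ.IsTopGenerator γ)]
        (𝔭 : HeightOneSpectrum (𝓞 K)), ((p : ℕ) : 𝓞 K) ∈ 𝔭.asIdeal → 𝔭.asIdeal.ramificationIdx (𝓞 ℚ) = 1 →
        𝔭.asIdeal.inertiaDeg (𝓞 ℚ) = 1 → ∀ (𝔭' : HeightOneSpectrum (𝓞 K)), ((p : ℕ) : 𝓞 K) ∈ 𝔭'.asIdeal → 𝔭' ≠ 𝔭 →
        ∀ (ι' : PadicAlgCl p ≃+* ℂ), SchneiderFree.BranchInducesPrime p ι' 𝔭 →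
        ∀ (ΩK : ℂ) (Ωp : ℂ_[p]) (Q : PowerSeries (PadicComplexInt p)), ΩK ≠ 0 → Ωp ≠ 0 →
          R1.IsBDPLFunctionInt p ι' 𝔭 κ γ Dt.f ΩK Ωp Q →
          (XAc.charIdeal (W.baseChange K) p κ 𝔭' ∅ γ).map (PowerSeries.map (R1.toCpInt p)) ≤ Ideal.span {Q} →
          (Module.Finite (IwasawaAlgebra p) (XAc (W.baseChange K) p κ 𝔭' ∅ γ) ∧
           Module.IsTorsion (IwasawaAlgebra p) (XAc (W.baseChange K) p κ 𝔭' ∅ γ) ∧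
           ∃ Q₀ : PowerSeries (PadicComplexInt p),
             Q = PowerSeries.C (R1.toCpInt p ((p : ℤ_[p]) ^
                   muInvariant p (XAc (W.baseChange K) p κ 𝔭' ∅ γ))) * Q₀ ∧
             (PowerSeries.map (IsLocalRing.residue (PadicComplexInt p)) Q₀).order =
               lambdaInvariant p (XAc (W.baseChange K) p κ 𝔭' ∅ γ))) :
    Summit.BirchSwinnertonDyer.BirchSwinnertonDyer.Theses.PrintCFram.BottomClassIndexLawFiveLe :=
  bottomClassIndexLawFiveLe_of_prints_of_flatIncl_of_upgrade h0 h1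
    (stub_invariantUpgrade_cmRamified_of_moduleInvariants hinvM)


/-! ### two norm facts on `𝓞_{ℂ_p}` (units ⟺ norm one) -/

/-- A unit of `𝓞_{ℂ_p}` has norm `1`. [folklore] -/
private theorem norm_eq_one_of_isUnit' {p : ℕ} [Fact p.Prime] {x : PadicComplexInt p} (hx : IsUnit x) :
    ‖(x : ℂ_[p])‖ = 1 := by
  obtain ⟨u, rfl⟩ := hx
  have h1 : ‖((u : PadicComplexInt p) : ℂ_[p])‖ * ‖(((u⁻¹ : (PadicComplexInt p)ˣ) : PadicComplexInt p) : ℂ_[p])‖ = 1 := by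
    rw [← norm_mul, ← MulMemClass.coe_mul, Units.mul_inv, OneMemClass.coe_one, norm_one]
  have ha := R1.norm_coe_padicComplexInt_le_one p (u : PadicComplexInt p)
  have hb := R1.norm_coe_padicComplexInt_le_one p ((u⁻¹ : (PadicComplexInt p)ˣ) : PadicComplexInt p)
  have h0 := norm_nonneg (((u : PadicComplexInt p)) : ℂ_[p])
  nlinarith

/-- An element of `𝓞_{ℂ_p}` of norm `1` is a unit (its inverse in `ℂ_p` has norm `1 ≤ 1`). [folklore] -/
private theorem isUnit_of_norm_eq_one' {p : ℕ} [Fact p.Prime] {x : PadicComplexInt p} (hx : ‖(x : ℂ_[p])‖ = 1) :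
    IsUnit x := by
  have hx0 : (x : ℂ_[p]) ≠ 0 := fun h => by simp [h] at hx
  have hinv : ‖(x : ℂ_[p])⁻¹‖ ≤ 1 := by rw [norm_inv, hx, inv_one]
  refine ⟨⟨x, ⟨(x : ℂ_[p])⁻¹, Literature.NumberTheory.LFunctions.Dwork.mem_unitBall.mpr hinv⟩, ?_, ?_⟩, rfl⟩
  · exact Subtype.ext (mul_inv_cancel₀ hx0)
  · exact Subtype.ext (inv_mul_cancel₀ hx0)

/-! ## v2 of the skeleton (ideator 09:04Z, LEAD-registered 10:0xZ): the «invariant MATCH» stub ⟹ the «invariant UPGRADE» stub -/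

/-- **Registered stub 2 of v2 (`stub_invariantMatch_cmRamified`, signature verbatim as hypothesis) ⟹ stub 2 of v1
(`stub_invariantUpgrade_cmRamified`, signature verbatim as conclusion)** — by the Literature hinge, without the structure theorem:
at a frame, the match gives `n`, the first `n` coefficients of `Q` in `𝔪_{𝓞_{ℂ_p}}` (so `ord Q̄ ≥ n`) and some `G` in the mapped
characteristic ideal with a UNIT `n`-th coefficient (so `Ḡ ≠ 0`, `ord Ḡ ≤ n`); the Eisenstein inclusion gives `Q ∣ G`, hence
`ord Q̄ ≤ ord Ḡ`, so `ord Q̄ = ord Ḡ = n` and `Associated Q G`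
(`Literature.RingTheory.PowerSeries.associated_of_dvd_of_order_map_residue_eq`), i.e. `(Q) = (G) ⊆` the ideal. (The ideator's
`invariantUpgrade_of_match` in the Cruxes file proves the same by a norm computation; this is the Theorems-side by-name socket.)
[cite: CastellaGrossiLeeSkinner2022, proof of Thm. 5.1.1 (arXiv:2008.02571 p. 23)] [cite: GreenbergVatsal2000, §1 p. 18, (1)–(2)] -/
theorem stub_invariantUpgrade_of_invariantMatch
    (hmatch : ∀ (p : ℕ) [Fact p.Prime] (W : WeierstrassCurve ℚ) [W.IsElliptic] [W.IsGloballyMinimal],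
      W.HasCM → CMRamified W p → 5 ≤ p → W.analyticRank = 1 →
      ∀ (N : ℕ) [NeZero N] (K : Type) [Field K] [NumberField K] (Dt : ModularParametrizationData W N),
      W.conductorNorm ℤ = N → IsImaginaryQuadratic K → SatisfiesHeegnerHypothesis N K →
      ∀ (κ : ZpExtension K p), κ.IsAnticyclotomic → ∀ (γ : Field.absoluteGaloisGroup K) [Fact (κ.IsTopGenerator γ)]
        (𝔭 : HeightOneSpectrum (𝓞 K)), ((p : ℕ) : 𝓞 K) ∈ 𝔭.asIdeal → 𝔭.asIdeal.ramificationIdx (𝓞 ℚ) = 1 →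
        𝔭.asIdeal.inertiaDeg (𝓞 ℚ) = 1 → ∀ (𝔭' : HeightOneSpectrum (𝓞 K)), ((p : ℕ) : 𝓞 K) ∈ 𝔭'.asIdeal → 𝔭' ≠ 𝔭 →
        ∀ (ι' : PadicAlgCl p ≃+* ℂ), SchneiderFree.BranchInducesPrime p ι' 𝔭 →
        ∀ (ΩK : ℂ) (Ωp : ℂ_[p]) (Q : PowerSeries (PadicComplexInt p)), ΩK ≠ 0 → Ωp ≠ 0 →
          R1.IsBDPLFunctionInt p ι' 𝔭 κ γ Dt.f ΩK Ωp Q →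
          ∃ n : ℕ, (∀ m < n, ‖((PowerSeries.coeff m Q : 𝓞_ℂ_[p]) : ℂ_[p])‖ < 1) ∧
            ∃ G ∈ (XAc.charIdeal (W.baseChange K) p κ 𝔭' ∅ γ).map (PowerSeries.map (R1.toCpInt p)),
              ‖((PowerSeries.coeff n G : 𝓞_ℂ_[p]) : ℂ_[p])‖ = 1) :
    ∀ (p : ℕ) [Fact p.Prime] (W : WeierstrassCurve ℚ) [W.IsElliptic] [W.IsGloballyMinimal],
      W.HasCM → CMRamified W p → 5 ≤ p → W.analyticRank = 1 →
      ∀ (N : ℕ) [NeZero N] (K : Type) [Field K] [NumberField K] (Dt : ModularParametrizationData W N),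
      W.conductorNorm ℤ = N → IsImaginaryQuadratic K → SatisfiesHeegnerHypothesis N K →
      ∀ (κ : ZpExtension K p), κ.IsAnticyclotomic → ∀ (γ : Field.absoluteGaloisGroup K) [Fact (κ.IsTopGenerator γ)]
        (𝔭 : HeightOneSpectrum (𝓞 K)), ((p : ℕ) : 𝓞 K) ∈ 𝔭.asIdeal → 𝔭.asIdeal.ramificationIdx (𝓞 ℚ) = 1 →
        𝔭.asIdeal.inertiaDeg (𝓞 ℚ) = 1 → ∀ (𝔭' : HeightOneSpectrum (𝓞 K)), ((p : ℕ) : 𝓞 K) ∈ 𝔭'.asIdeal → 𝔭' ≠ 𝔭 →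
        ∀ (ι' : PadicAlgCl p ≃+* ℂ), SchneiderFree.BranchInducesPrime p ι' 𝔭 →
        ∀ (ΩK : ℂ) (Ωp : ℂ_[p]) (Q : PowerSeries (PadicComplexInt p)), ΩK ≠ 0 → Ωp ≠ 0 →
          R1.IsBDPLFunctionInt p ι' 𝔭 κ γ Dt.f ΩK Ωp Q →
          (XAc.charIdeal (W.baseChange K) p κ 𝔭' ∅ γ).map (PowerSeries.map (R1.toCpInt p)) ≤ Ideal.span {Q} →
          Ideal.span {Q} ≤ (XAc.charIdeal (W.baseChange K) p κ 𝔭' ∅ γ).map (PowerSeries.map (R1.toCpInt p)) := by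
  intro p _ W _ _ hCM hram h5 hr N _ K _ _ Dt hN hK hHN κ hκ γ _ 𝔭 h𝔭 he hf 𝔭' h𝔭' hne ι' hind ΩK Ωp Q hΩK hΩp hBDP hle
  obtain ⟨n, hQn, G, hGI, hGn⟩ :=
    hmatch p W hCM hram h5 hr N K Dt hN hK hHN κ hκ γ 𝔭 h𝔭 he hf 𝔭' h𝔭' hne ι' hind ΩK Ωp Q hΩK hΩp hBDP
  -- `Q ∣ G` from the Eisenstein inclusion
  have hQG : Q ∣ G := Ideal.mem_span_singleton.mp (hle hGI)
  -- residues: a coefficient of norm `< 1` reduces to `0`, one of norm `1` is a unit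
  have hres0 : ∀ m < n, PowerSeries.coeff m (PowerSeries.map (IsLocalRing.residue (PadicComplexInt p)) Q) = 0 := by
    intro m hm
    rw [PowerSeries.coeff_map, IsLocalRing.residue_eq_zero_iff, IsLocalRing.mem_maximalIdeal, mem_nonunits_iff]
    intro hu
    exact absurd (norm_eq_one_of_isUnit' hu) (ne_of_lt (hQn m hm))
  have hGunit : IsUnit (PowerSeries.coeff n G : PadicComplexInt p) :=
    isUnit_of_norm_eq_one' hGn
  have hGbar_n : PowerSeries.coeff n (PowerSeries.map (IsLocalRing.residue (PadicComplexInt p)) G) ≠ 0 := by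
    rw [PowerSeries.coeff_map, Ne, IsLocalRing.residue_eq_zero_iff]
    exact fun hmem => (IsLocalRing.mem_maximalIdeal _).mp hmem |> mem_nonunits_iff.mp <| hGunit
  have hGbar : PowerSeries.map (IsLocalRing.residue (PadicComplexInt p)) G ≠ 0 := fun h0 => hGbar_n (by simp [h0])
  -- orders: `n ≤ ord Q̄ ≤ ord Ḡ ≤ n`
  have hQge : (n : ℕ∞) ≤ (PowerSeries.map (IsLocalRing.residue (PadicComplexInt p)) Q).order :=
    PowerSeries.nat_le_order _ n hres0
  have hGle : (PowerSeries.map (IsLocalRing.residue (PadicComplexInt p)) G).order ≤ n :=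
    PowerSeries.order_le n hGbar_n
  have hQleG : (PowerSeries.map (IsLocalRing.residue (PadicComplexInt p)) Q).order ≤
      (PowerSeries.map (IsLocalRing.residue (PadicComplexInt p)) G).order := by
    obtain ⟨h, rfl⟩ := hQG
    rw [map_mul]
    exact PowerSeries.le_order_mul _ _ |>.trans' (by simp)
  have hord : (PowerSeries.map (IsLocalRing.residue (PadicComplexInt p)) Q).order =
      (PowerSeries.map (IsLocalRing.residue (PadicComplexInt p)) G).order :=
    le_antisymm hQleG ((hGle.trans hQge))
  have hassoc := Literature.RingTheory.PowerSeries.associated_of_dvd_of_order_map_residue_eq hQG hGbar hord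
  exact Ideal.span_singleton_le_iff_mem _ |>.mpr (by
    obtain ⟨u, hu⟩ := hassoc.symm
    rw [← hu]
    exact Ideal.mul_mem_right _ _ hGI)

/-- **END STATE of v2, BY NAME, in the Theorems tree**: C2 ⟸ the facts-stub ∧ the Eisenstein inclusion ∧ the invariant MATCH
(the three REGISTERED stubs of the v2 skeleton of record, verbatim as hypotheses). CONDITIONAL; nothing booked.
[cite: CastellaGrossiLeeSkinner2022, Thm. 3.2.1 and proof of Thm. 5.1.1 (arXiv:2008.02571 pp. 4, 23)]
[cite: JetchevSkinnerWan2017, §7.4.1 (arXiv:1512.06894 p. 30)] [cite: Miller2011LMS, Def. 1.1 (arXiv:1010.2431 p. 3)] -/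
theorem bottomClassIndexLawFiveLe_of_prints_of_flatIncl_of_invariantMatch
    (h0 : Hsieh2014.thmA_exists_isHsiehLFunction_unrPeriod_anyLevel ∧
    LiuZhangZhang2018.thm151_thm153_modularCurve_heegnerVector_additive ∧
    ToricPublishedInputs ∧
    (∀ (K : Type) [Field K] [NumberField K], poitouTate_selmerStructure_duality K) ∧
    (∀ (K : Type) [Field K] [NumberField K], poitouTate_sha_tateDual K) ∧
    (∀ (K : Type) [Field K] [NumberField K] (v : HeightOneSpectrum (𝓞 K)),
      localEulerPoincareCharacteristic (v.adicCompletion K)) ∧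
    fieldCdLE_two_of_numberField ∧
    (∀ (K : Type) [Field K] [NumberField K] (p : ℕ) [Fact p.Prime],
      ZpExtension.decomp_not_le_kerSubgroup_of_isAnticyclotomic K p) ∧
    bsdTriple_of_hasCM_of_L_one_ne_zero ∧
    hasEntireLFunction_rat ∧
    bsdRHS_eq_of_isIsogenous)
    (h1 : ∀ (p : ℕ) [Fact p.Prime] (W : WeierstrassCurve ℚ) [W.IsElliptic] [W.IsGloballyMinimal],
      W.HasCM → CMRamified W p → 5 ≤ p → W.analyticRank = 1 →
      ∀ (N : ℕ) [NeZero N] (K : Type) [Field K] [NumberField K] (Dt : ModularParametrizationData W N),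
      W.conductorNorm ℤ = N → IsImaginaryQuadratic K → SatisfiesHeegnerHypothesis N K →
      ∀ (κ : ZpExtension K p), κ.IsAnticyclotomic → ∀ (γ : Field.absoluteGaloisGroup K) [Fact (κ.IsTopGenerator γ)]
        (𝔭 : HeightOneSpectrum (𝓞 K)), ((p : ℕ) : 𝓞 K) ∈ 𝔭.asIdeal → 𝔭.asIdeal.ramificationIdx (𝓞 ℚ) = 1 →
        𝔭.asIdeal.inertiaDeg (𝓞 ℚ) = 1 → ∀ (𝔭' : HeightOneSpectrum (𝓞 K)), ((p : ℕ) : 𝓞 K) ∈ 𝔭'.asIdeal → 𝔭' ≠ 𝔭 →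
        ∀ (ι' : PadicAlgCl p ≃+* ℂ), SchneiderFree.BranchInducesPrime p ι' 𝔭 →
        ∀ (ΩK : ℂ) (Ωp : ℂ_[p]) (Q : PowerSeries (PadicComplexInt p)), ΩK ≠ 0 → Ωp ≠ 0 →
          R1.IsBDPLFunctionInt p ι' 𝔭 κ γ Dt.f ΩK Ωp Q →
          (XAc.charIdeal (W.baseChange K) p κ 𝔭' ∅ γ).map (PowerSeries.map (R1.toCpInt p)) ≤ Ideal.span {Q})
    (hmatch : ∀ (p : ℕ) [Fact p.Prime] (W : WeierstrassCurve ℚ) [W.IsElliptic] [W.IsGloballyMinimal],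
      W.HasCM → CMRamified W p → 5 ≤ p → W.analyticRank = 1 →
      ∀ (N : ℕ) [NeZero N] (K : Type) [Field K] [NumberField K] (Dt : ModularParametrizationData W N),
      W.conductorNorm ℤ = N → IsImaginaryQuadratic K → SatisfiesHeegnerHypothesis N K →
      ∀ (κ : ZpExtension K p), κ.IsAnticyclotomic → ∀ (γ : Field.absoluteGaloisGroup K) [Fact (κ.IsTopGenerator γ)]
        (𝔭 : HeightOneSpectrum (𝓞 K)), ((p : ℕ) : 𝓞 K) ∈ 𝔭.asIdeal → 𝔭.asIdeal.ramificationIdx (𝓞 ℚ) = 1 →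
        𝔭.asIdeal.inertiaDeg (𝓞 ℚ) = 1 → ∀ (𝔭' : HeightOneSpectrum (𝓞 K)), ((p : ℕ) : 𝓞 K) ∈ 𝔭'.asIdeal → 𝔭' ≠ 𝔭 →
        ∀ (ι' : PadicAlgCl p ≃+* ℂ), SchneiderFree.BranchInducesPrime p ι' 𝔭 →
        ∀ (ΩK : ℂ) (Ωp : ℂ_[p]) (Q : PowerSeries (PadicComplexInt p)), ΩK ≠ 0 → Ωp ≠ 0 →
          R1.IsBDPLFunctionInt p ι' 𝔭 κ γ Dt.f ΩK Ωp Q →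
          ∃ n : ℕ, (∀ m < n, ‖((PowerSeries.coeff m Q : 𝓞_ℂ_[p]) : ℂ_[p])‖ < 1) ∧
            ∃ G ∈ (XAc.charIdeal (W.baseChange K) p κ 𝔭' ∅ γ).map (PowerSeries.map (R1.toCpInt p)),
              ‖((PowerSeries.coeff n G : 𝓞_ℂ_[p]) : ℂ_[p])‖ = 1) :
    Summit.BirchSwinnertonDyer.BirchSwinnertonDyer.Theses.PrintCFram.BottomClassIndexLawFiveLe :=
  bottomClassIndexLawFiveLe_of_prints_of_flatIncl_of_upgrade h0 h1 (stub_invariantUpgrade_of_invariantMatch hmatch)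

end Summit.BirchSwinnertonDyer.BirchSwinnertonDyer.Theorems.PrintCFram.EisensteinResourceBdpLine

end
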